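import Mathlib.MeasureTheory.Constructions.BorelSpace.WithTop
import Literature.Probability.Process.ProgressiveDensity
import Literature.Probability.Process.DoobL2Inequality
import Literature.Analysis.FunctionSpaces.ItoProcessesProofs
import HarnessLib

/-!
# Construction of the Itô integral, V: stopping at an optional time

The identity `(K·B)^ρ = (K 1_{[0,ρ]})·B` (Revuz–Yor IV (2.5), (2.10)(ii)) for the characterised
Itô integral `Literature.Probability.Process.IsItoIntegral` and an *optional* time `ρ` of a raw filtration
(`{ρ < t} ∈ 𝓕 t` for all `t`), stated with the truncated integrand
`Literature.trunc ρ H = H 1_{[0,ρ]}` and the optional-time plumbing (`isStronglyProgressive_trunc`,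
`coe_untopA_min`) of `Literature/Analysis/FunctionSpaces/ItoProcessesProofs.lean`, whose named
facts S2 (`lintegral_iSup_itoIntegral_sub_sq_le`) and S4 (truncation) this file serves:

* `SimpleProcess.stop` — a bounded simple process stopped at a random time taking values among
  its partition times (or beyond): again a simple process, whose step process is the truncated
  one (`toProcess_stop`) and whose elementary integral is the stopped elementary integral
  (`integral_stop`);
* `SimpleProcess.withGrid` — refinement of the partition by the dyadic grid of mesh `2⁻ⁿ`;
* `Literature.dyadicSucc n ρ = (⌊2ⁿ ρ⌋ + 1) / 2ⁿ` — the dyadic upper approximation of an optional time: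
  `ρ ≤ dyadicSucc n ρ ≤ ρ + 2⁻ⁿ`, grid valued, and `{dyadicSucc n ρ ≤ t} = {ρ < ⌊2ⁿt⌋/2ⁿ} ∈ 𝓕 t`
  (a genuine stopping time of the raw filtration);
* `SimpleProcess.stopApprox` — the approximants `Hₙ 1_{(0, ρₙ]}` of `H 1_{[0,ρ]}`; they form
  an approximating sequence (`isApproxSeq_stopApprox`) and their elementary integrals are the
  stopped ones, which converge u.c.p. to `J^ρ` (`tendstoUCP_stoppedProcess_dyadicSucc`, via the
  oscillation estimate `tendsto_measure_osc` for a.s. continuous paths);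
* `Literature.Probability.Process.ae_eq_stoppedProcess_of_tendstoUCP`, `Literature.Probability.Process.IsItoIntegral.ae_eq_stoppedProcess` — **if `J`
  is the u.c.p. limit of `Hₙ·B` (e.g. `J = ∫ H dB`) and `J' = ∫ H 1_{[0,ρ]} dB` in the sense of
  `IsItoIntegral`, then `J'` is indistinguishable from `J^ρ`.**

The last section derives the **`L²` maximal inequality** behind every Picard iteration for
SDEs (Revuz–Yor IX (2.1), "by the Doob and Cauchy–Schwarz inequalities"): for Itô integrals
`J = ∫ H dB`, `J' = ∫ H' dB` (`H, H'` progressive),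
`E[sup_{s ≤ t} (J_s - J'_s)²] ≤ 4 E[∫₀ᵗ (H_s - H'_s)² ds]`
(`Literature.Probability.Process.IsItoIntegral.lintegral_iSup_sub_sq_le`): linearity of u.c.p. limits
(`IsItoIntegral.tendstoUCP_integral_sub`), truncation of `K = H - H'` at the deterministic
(optional) time `t`, the square-integrable martingale `∫ K1_{[0,t]} dB`
(`exists_isItoIntegral_of_sqErr_ne_top`) indistinguishable from `(J - J')^t`
(`ae_eq_stoppedProcess_of_tendstoUCP`), Doob's `L²` inequality
(`doob_lintegral_iSup_sq_le_of_continuous`) and the isometry in the limit (Minkowski).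

## References

* D. Revuz, M. Yor, *Continuous Martingales and Brownian Motion* (3rd ed., 1999), Ch. IV,
  Thm (2.2) (`‖K·M‖_{H²} = ‖K‖_{L²(M)}`), Prop. (2.5) (`K 1_{[0,T]}·M = (K·M)^T`),
  Prop. (2.10)(ii); Ch. I, Prop. (4.11) (dyadic approximation of optional times from above);
  Ch. II, Thm (1.7) (Doob's `L²` inequality); Ch. IX, proof of Thm (2.1).
-/

open MeasureTheory ProbabilityTheory Filter Finset
open scoped NNReal ENNReal Topology

noncomputable section

namespace Literature.Probability.Process

variable {Ω : Type*} {m : MeasurableSpace Ω} {𝓕 : Filtration ℝ≥0 m} {μ : Measure Ω}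

/-! ### Stopped integrands -/

namespace SimpleProcess

/-! ### Stopping a simple process at a random time valued in its partition -/

section Stop

variable (H : SimpleProcess m 𝓕) (τ : Ω → WithTop ℝ≥0)
  (hτ : ∀ i, i < H.times.length → MeasurableSet[𝓕 (H.time i)] {ω | τ ω ≤ H.time i})

/-- **Stopping a bounded simple process** `H = ∑ Hᵢ 1_{(tᵢ,tᵢ₊₁]}` at a random time `τ` with
`{τ ≤ tᵢ} ∈ 𝓕 tᵢ`: the simple process with the same partition and values `Hᵢ 1_{τ > tᵢ}`.
When `τ` takes its values among the partition times (or beyond the last one, or `⊤`), this is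
`H 1_{(0,τ]}` (`toProcess_stop`) and its elementary integral is the stopped one
(`integral_stop`).
Revuz–Yor, *Continuous Martingales and Brownian Motion* (1999), Ch. IV, Prop. (2.5). [folklore] -/
def stop : SimpleProcess m 𝓕 where
  times := H.times
  sorted := H.sorted
  value i := {ω | ¬ τ ω ≤ (H.time i : WithTop ℝ≥0)}.indicator (H.value i)
  measurable i hi := by
    have heq : H.times.get ⟨i, hi⟩ = H.time i := by rw [H.time_eq_getElem hi]; rfl
    rw [heq]
    exact (H.stronglyMeasurable_value hi).indicator (hτ i hi).compl
  bounded := by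
    obtain ⟨C, hC⟩ := H.bounded
    refine ⟨C, fun i ω ↦ ?_⟩
    by_cases h : ω ∈ {ω | ¬ τ ω ≤ (H.time i : WithTop ℝ≥0)}
    · rw [Set.indicator_of_mem h]; exact hC i ω
    · rw [Set.indicator_of_notMem h, abs_zero]; exact (abs_nonneg _).trans (hC i ω)

/-- Stopping keeps the partition. [folklore] -/
@[simp] theorem stop_times : (H.stop τ hτ).times = H.times := rfl

/-- Stopping keeps the partition (total reading). [folklore] -/
@[simp] theorem stop_time (i : ℕ) : (H.stop τ hτ).time i = H.time i := rfl

/-- The values of the stopped process. [folklore] -/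
theorem stop_value (i : ℕ) (ω : Ω) : (H.stop τ hτ).value i ω =
    if τ ω ≤ (H.time i : WithTop ℝ≥0) then 0 else H.value i ω := by
  show {ω | ¬ τ ω ≤ (H.time i : WithTop ℝ≥0)}.indicator (H.value i) ω = _
  by_cases h : τ ω ≤ (H.time i : WithTop ℝ≥0)
  · rw [Set.indicator_of_notMem (show ω ∉ {ω | ¬ τ ω ≤ (H.time i : WithTop ℝ≥0)} from
      fun h' ↦ h' h), if_pos h]
  · rw [Set.indicator_of_mem (show ω ∈ {ω | ¬ τ ω ≤ (H.time i : WithTop ℝ≥0)} from h), if_neg h]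

variable {τ}

/-- **The step process of the stopped process is the truncated step process**, provided `τ`
does not fall strictly inside a partition interval.
Revuz–Yor, *Continuous Martingales and Brownian Motion* (1999), Ch. IV, Prop. (2.5). [folklore] -/
theorem toProcess_stop
    (hcell : ∀ ω i, i + 1 < H.times.length → (H.time i : WithTop ℝ≥0) < τ ω →
      (H.time (i + 1) : WithTop ℝ≥0) ≤ τ ω) (s : ℝ≥0) (ω : Ω) :
    (H.stop τ hτ).toProcess s ω = if (s : WithTop ℝ≥0) ≤ τ ω then H.toProcess s ω else 0 := by
  unfold toProcess
  simp only [stop_times, stop_time]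
  by_cases h : ∃ j ∈ range (H.times.length - 1), s ∈ Set.Ioc (H.time j) (H.time (j + 1))
  · obtain ⟨j, hj, hsj⟩ := h
    have hj' : j + 1 < H.times.length := by have := mem_range.1 hj; omega
    have hne : ∀ i ∈ range (H.times.length - 1), i ≠ j →
        s ∉ Set.Ioc (H.time i) (H.time (i + 1)) := fun i hi hij ↦
      H.not_mem_Ioc_of_mem_Ioc (by have := mem_range.1 hi; omega) hj' hij hsj
    rw [sum_eq_single j (fun i hi hij ↦ Set.indicator_of_notMem (hne i hi hij) _)
        (fun h ↦ (h hj).elim),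
      sum_eq_single j (fun i hi hij ↦ Set.indicator_of_notMem (hne i hi hij) _)
        (fun h ↦ (h hj).elim),
      Set.indicator_of_mem hsj, Set.indicator_of_mem hsj, stop_value]
    by_cases hτj : τ ω ≤ (H.time j : WithTop ℝ≥0)
    · -- `τ ≤ t_j < s`
      rw [if_pos hτj, if_neg]
      exact fun hs ↦ (not_lt.2 (hs.trans hτj)) (WithTop.coe_lt_coe.2 hsj.1)
    · rw [if_neg hτj, if_pos]
      exact (WithTop.coe_le_coe.2 hsj.2).trans (hcell ω j hj' (not_le.1 hτj))
  · push Not at h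
    rw [sum_eq_zero (fun i hi ↦ Set.indicator_of_notMem (h i hi) _),
      sum_eq_zero (fun i hi ↦ Set.indicator_of_notMem (h i hi) _)]
    all_goals simp

/-- **The elementary integral of the stopped process is the stopped elementary integral**
(`(H 1_{(0,τ]})·B = (H·B)^τ`), provided `τ` does not fall strictly inside a partition interval.
Revuz–Yor, *Continuous Martingales and Brownian Motion* (1999), Ch. IV, Prop. (2.5).
[cite: RevuzYor1999, Ch. IV Prop. (2.5)] -/
theorem integral_stop
    (hcell : ∀ ω i, i + 1 < H.times.length → (H.time i : WithTop ℝ≥0) < τ ω →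
      (H.time (i + 1) : WithTop ℝ≥0) ≤ τ ω) (B : ℝ≥0 → Ω → ℝ) (s : ℝ≥0) (ω : Ω) :
    (H.stop τ hτ).integral B s ω = stoppedProcess (H.integral B) τ s ω := by
  rw [stoppedProcess]
  set r : ℝ≥0 := (min (s : WithTop ℝ≥0) (τ ω)).untopA with hr
  have hrco : (r : WithTop ℝ≥0) = min (s : WithTop ℝ≥0) (τ ω) := Literature.Analysis.FunctionSpaces.coe_untopA_min s (τ ω)
  unfold integral
  simp only [stop_times, stop_time]
  refine sum_congr rfl fun i hi ↦ ?_
  have hi' : i + 1 < H.times.length := by have := mem_range.1 hi; omega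
  rw [stop_value]
  by_cases hτi : τ ω ≤ (H.time i : WithTop ℝ≥0)
  · -- `r ≤ τ ≤ tᵢ ≤ tᵢ₊₁`: both increments vanish
    rw [if_pos hτi, zero_mul]
    have hri : r ≤ H.time i := by
      rw [← WithTop.coe_le_coe, hrco]; exact (min_le_right _ _).trans hτi
    rw [min_eq_left (hri.trans (H.time_mono (Nat.le_succ i) hi')), min_eq_left hri, sub_self,
      mul_zero]
  · -- `tᵢ < τ`, hence `tᵢ₊₁ ≤ τ`: stopping is invisible on this interval
    rw [if_neg hτi]
    have h1 : (H.time (i + 1) : WithTop ℝ≥0) ≤ τ ω := hcell ω i hi' (not_le.1 hτi)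
    have h0 : (H.time i : WithTop ℝ≥0) ≤ τ ω := (not_le.1 hτi).le
    have e1 : min r (H.time (i + 1)) = min s (H.time (i + 1)) := by
      rw [← WithTop.coe_inj, WithTop.coe_min, WithTop.coe_min, hrco, min_assoc,
        min_eq_right h1]
    have e0 : min r (H.time i) = min s (H.time i) := by
      rw [← WithTop.coe_inj, WithTop.coe_min, WithTop.coe_min, hrco, min_assoc,
        min_eq_right h0]
    rw [e1, e0]

end Stop

/-! ### Merging a dyadic grid into the partition -/

/-- The dyadic grid `k/2ⁿ`, `k ≤ ⌈T 2ⁿ⌉`, covering `[0, T]`. [folklore] -/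
def dyadicGrid (T : ℝ≥0) (n : ℕ) : List ℝ≥0 :=
  (List.range (⌈(T : ℝ) * 2 ^ n⌉₊ + 1)).map fun k : ℕ ↦ (k : ℝ≥0) / 2 ^ n

/-- Grid points are in the grid list. [folklore] -/
theorem div_mem_dyadicGrid {T : ℝ≥0} {n k : ℕ} (hk : k ≤ ⌈(T : ℝ) * 2 ^ n⌉₊) :
    (k : ℝ≥0) / 2 ^ n ∈ dyadicGrid T n :=
  List.mem_map.2 ⟨k, List.mem_range.2 (by omega), rfl⟩

/-- Elements of the grid list are at most the top grid point `⌈T 2ⁿ⌉ / 2ⁿ`. [folklore] -/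
theorem le_of_mem_dyadicGrid {T : ℝ≥0} {n : ℕ} {x : ℝ≥0} (hx : x ∈ dyadicGrid T n) :
    x ≤ ((⌈(T : ℝ) * 2 ^ n⌉₊ : ℕ) : ℝ≥0) / 2 ^ n := by
  obtain ⟨k, hk, rfl⟩ := List.mem_map.1 hx
  have hk' : k ≤ ⌈(T : ℝ) * 2 ^ n⌉₊ := by have := List.mem_range.1 hk; omega
  gcongr

/-- `T` is at most the top grid point `⌈T 2ⁿ⌉ / 2ⁿ`. [folklore] -/
theorem le_top_dyadicGrid (T : ℝ≥0) (n : ℕ) : T ≤ ((⌈(T : ℝ) * 2 ^ n⌉₊ : ℕ) : ℝ≥0) / 2 ^ n := by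
  rw [le_div_iff₀ (pow_pos two_pos n), ← NNReal.coe_le_coe]
  push_cast
  exact Nat.le_ceil _

section WithGrid

variable (H : SimpleProcess m 𝓕) (n : ℕ)

/-- The partition of `H` merged with the dyadic grid of mesh `2⁻ⁿ` up to (just beyond) its last
time, sorted. [folklore] -/
def gridMergeTimes : List ℝ≥0 :=
  ((H.times ++ dyadicGrid (H.time (H.times.length - 1)) n).toFinset).sort

/-- The merged list is strictly increasing. [folklore] -/
theorem sortedLT_gridMergeTimes : (H.gridMergeTimes n).SortedLT := Finset.sortedLT_sort _

/-- The merged list contains the partition of `H`. [folklore] -/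
theorem subset_gridMergeTimes : H.times ⊆ H.gridMergeTimes n := fun x hx ↦ by
  rw [gridMergeTimes, Finset.mem_sort, List.mem_toFinset]
  exact List.mem_append_left _ hx

/-- The merged list contains the grid. [folklore] -/
theorem grid_subset_gridMergeTimes :
    dyadicGrid (H.time (H.times.length - 1)) n ⊆ H.gridMergeTimes n := fun x hx ↦ by
  rw [gridMergeTimes, Finset.mem_sort, List.mem_toFinset]
  exact List.mem_append_right _ hx

/-- Every merged time is at most the top grid point. [folklore] -/
theorem le_of_mem_gridMergeTimes {x : ℝ≥0} (hx : x ∈ H.gridMergeTimes n) :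
    x ≤ ((⌈((H.time (H.times.length - 1) : ℝ≥0) : ℝ) * 2 ^ n⌉₊ : ℕ) : ℝ≥0) / 2 ^ n := by
  rw [gridMergeTimes, Finset.mem_sort, List.mem_toFinset, List.mem_append] at hx
  rcases hx with hx | hx
  · obtain ⟨p, hp, rfl⟩ := H.exists_time_eq_of_mem hx
    exact (H.time_mono (by omega) (by omega)).trans (le_top_dyadicGrid _ n)
  · exact le_of_mem_dyadicGrid hx

/-- **Refinement of a simple process by the dyadic grid of mesh `2⁻ⁿ`** (same step process,
same elementary integrals; every dyadic point below the last partition time becomes a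
partition time).
Revuz–Yor, *Continuous Martingales and Brownian Motion* (1999), Ch. IV, §2 ("considering
subdivisions including the `tᵢ`'s"). [folklore] -/
def withGrid : SimpleProcess m 𝓕 :=
  H.refine (H.gridMergeTimes n) (H.sortedLT_gridMergeTimes n) (H.subset_gridMergeTimes n)

/-- The partition of the grid refinement. [folklore] -/
@[simp] theorem withGrid_times : (H.withGrid n).times = H.gridMergeTimes n := rfl

/-- Grid refinement does not change the step process. [folklore] -/
theorem toProcess_withGrid (s : ℝ≥0) (ω : Ω) : (H.withGrid n).toProcess s ω = H.toProcess s ω :=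
  H.toProcess_refine _ _ _ s ω

/-- Grid refinement does not change elementary integrals. [folklore] -/
theorem integral_withGrid (B : ℝ≥0 → Ω → ℝ) (s : ℝ≥0) (ω : Ω) :
    (H.withGrid n).integral B s ω = H.integral B s ω :=
  H.integral_refine _ _ _ B s ω

/-- **A grid-valued time never falls strictly inside an interval of the grid refinement**: if
`τ ω ∈ {k/2ⁿ : k ∈ ℕ} ∪ {⊤}` then `tᵢ < τ ω` forces `tᵢ₊₁ ≤ τ ω` for the refined partition.
[folklore] -/
theorem withGrid_cell {τ : Ω → WithTop ℝ≥0}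
    (hτv : ∀ ω, τ ω = ⊤ ∨ ∃ k : ℕ, τ ω = (((k : ℝ≥0) / 2 ^ n : ℝ≥0) : WithTop ℝ≥0)) (ω : Ω) (i : ℕ)
    (hi : i + 1 < (H.withGrid n).times.length) (hlt : ((H.withGrid n).time i : WithTop ℝ≥0) < τ ω) :
    ((H.withGrid n).time (i + 1) : WithTop ℝ≥0) ≤ τ ω := by
  set R := H.withGrid n with hR
  rcases hτv ω with htop | ⟨k, hk⟩
  · rw [htop]; exact le_top
  rw [hk] at hlt ⊢
  by_contra hcon
  rw [not_le, WithTop.coe_lt_coe] at hcon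
  rw [WithTop.coe_lt_coe] at hlt
  -- `k/2ⁿ < t_{i+1} ≤ top grid point`, so `k/2ⁿ` is a grid point, hence a partition time
  have hmem : R.time (i + 1) ∈ H.gridMergeTimes n := by
    have := R.time_mem hi
    rwa [withGrid_times] at this
  have htopg := H.le_of_mem_gridMergeTimes n hmem
  have hklt : (k : ℝ≥0) / 2 ^ n < ((⌈((H.time (H.times.length - 1) : ℝ≥0) : ℝ) * 2 ^ n⌉₊ : ℕ) : ℝ≥0) / 2 ^ n :=
    hcon.trans_le htopg
  have hk' : k ≤ ⌈((H.time (H.times.length - 1) : ℝ≥0) : ℝ) * 2 ^ n⌉₊ := by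
    have := (div_lt_div_iff_of_pos_right (pow_pos two_pos n)).1 hklt
    exact_mod_cast this.le
  have hkmem : (k : ℝ≥0) / 2 ^ n ∈ R.times := by
    rw [hR, withGrid_times]
    exact H.grid_subset_gridMergeTimes n (div_mem_dyadicGrid hk')
  obtain ⟨p, hp, hpk⟩ := R.exists_time_eq_of_mem hkmem
  rw [← hpk] at hlt hcon
  have h1 : i < p := (R.time_lt_time_iff (by omega) hp).1 hlt
  have h2 : p < i + 1 := (R.time_lt_time_iff hp hi).1 hcon
  omega

end WithGrid

end SimpleProcess

/-! ### Dyadic upper approximation of an optional time -/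

/-- **Dyadic upper approximation of a random time**: `dyadicSucc n ρ = (⌊2ⁿ ρ⌋ + 1) / 2ⁿ`
(`⊤` if `ρ = ⊤`), the least point of the grid `2⁻ⁿ ℕ` strictly above `ρ`. If `ρ` is optional
for a raw filtration (`{ρ < t} ∈ 𝓕 t`), then `dyadicSucc n ρ` is a stopping time of it
(`measurableSet_dyadicSucc_le`), and `ρ ≤ dyadicSucc n ρ ≤ ρ + 2⁻ⁿ`.
Revuz–Yor, *Continuous Martingales and Brownian Motion* (1999), Ch. I, Prop. (4.11);
Karatzas–Shreve (1991), Problem 1.2.24. [folklore] -/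
noncomputable def dyadicSucc (n : ℕ) (ρ : Ω → WithTop ℝ≥0) : Ω → WithTop ℝ≥0 :=
  fun ω ↦ (ρ ω).map fun a : ℝ≥0 ↦ ((⌊(a : ℝ) * 2 ^ n⌋₊ + 1 : ℕ) : ℝ≥0) / 2 ^ n

section DyadicSucc

variable {ρ : Ω → WithTop ℝ≥0} {n : ℕ}

/-- The dyadic successor of a finite time. [folklore] -/
theorem dyadicSucc_of_eq_coe {ω : Ω} {a : ℝ≥0} (h : ρ ω = a) :
    dyadicSucc n ρ ω = (((⌊(a : ℝ) * 2 ^ n⌋₊ + 1 : ℕ) : ℝ≥0) / 2 ^ n : ℝ≥0) := by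
  rw [dyadicSucc, h]; rfl

/-- The dyadic successor of `⊤` is `⊤`. [folklore] -/
theorem dyadicSucc_of_eq_top {ω : Ω} (h : ρ ω = ⊤) : dyadicSucc n ρ ω = ⊤ := by
  simp [dyadicSucc, h]

/-- The real inequalities behind `dyadicSucc`: `a < (⌊a 2ⁿ⌋ + 1)/2ⁿ ≤ a + 2⁻ⁿ`. [folklore] -/
theorem lt_floor_add_one_div_and_le (a : ℝ≥0) (n : ℕ) :
    a < ((⌊(a : ℝ) * 2 ^ n⌋₊ + 1 : ℕ) : ℝ≥0) / 2 ^ n ∧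
      ((⌊(a : ℝ) * 2 ^ n⌋₊ + 1 : ℕ) : ℝ≥0) / 2 ^ n ≤ a + 1 / 2 ^ n := by
  have h2 : (0 : ℝ) < 2 ^ n := pow_pos two_pos n
  constructor
  · rw [lt_div_iff₀ (pow_pos two_pos n), ← NNReal.coe_lt_coe]
    push_cast
    exact Nat.lt_floor_add_one _
  · rw [div_le_iff₀ (pow_pos two_pos n), ← NNReal.coe_le_coe]
    push_cast
    have hfl : (⌊(a : ℝ) * 2 ^ n⌋₊ : ℝ) ≤ (a : ℝ) * 2 ^ n := Nat.floor_le (by positivity)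
    have heq : ((a : ℝ) + 1 / 2 ^ n) * 2 ^ n = (a : ℝ) * 2 ^ n + 1 := by field_simp
    rw [heq]
    linarith

/-- `ρ ≤ dyadicSucc n ρ`. [folklore] -/
theorem le_dyadicSucc (ω : Ω) : ρ ω ≤ dyadicSucc n ρ ω := by
  cases h : ρ ω with
  | top => rw [dyadicSucc_of_eq_top h]
  | coe a =>
    rw [dyadicSucc_of_eq_coe h]
    exact WithTop.coe_le_coe.2 (lt_floor_add_one_div_and_le a n).1.le

/-- `ρ < dyadicSucc n ρ` where `ρ` is finite. [folklore] -/
theorem lt_dyadicSucc {ω : Ω} {a : ℝ≥0} (h : ρ ω = a) : ρ ω < dyadicSucc n ρ ω := by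
  rw [dyadicSucc_of_eq_coe h, h]
  exact WithTop.coe_lt_coe.2 (lt_floor_add_one_div_and_le a n).1

/-- `dyadicSucc n ρ ≤ ρ + 2⁻ⁿ` where `ρ` is finite. [folklore] -/
theorem dyadicSucc_le_add {ω : Ω} {a : ℝ≥0} (h : ρ ω = a) :
    dyadicSucc n ρ ω ≤ ((a + 1 / 2 ^ n : ℝ≥0) : WithTop ℝ≥0) := by
  rw [dyadicSucc_of_eq_coe h]
  exact WithTop.coe_le_coe.2 (lt_floor_add_one_div_and_le a n).2

/-- The dyadic successor takes its values in the grid `2⁻ⁿ ℕ ∪ {⊤}`. [folklore] -/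
theorem dyadicSucc_eq_top_or (ω : Ω) :
    dyadicSucc n ρ ω = ⊤ ∨ ∃ k : ℕ, dyadicSucc n ρ ω = (((k : ℝ≥0) / 2 ^ n : ℝ≥0) : WithTop ℝ≥0) := by
  cases h : ρ ω with
  | top => exact Or.inl (dyadicSucc_of_eq_top h)
  | coe a => exact Or.inr ⟨_, dyadicSucc_of_eq_coe h⟩

/-- **The stopping-time property**: `dyadicSucc n ρ ≤ t ↔ ρ < ⌊t 2ⁿ⌋ / 2ⁿ`. [folklore] -/
theorem dyadicSucc_le_coe_iff (ω : Ω) (t : ℝ≥0) :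
    dyadicSucc n ρ ω ≤ t ↔ ρ ω < Literature.Analysis.FunctionSpaces.dyadicFloor n t := by
  have h2 : (0 : ℝ) < 2 ^ n := pow_pos two_pos n
  cases h : ρ ω with
  | top =>
    rw [dyadicSucc_of_eq_top h]
    constructor
    · intro h'; exact absurd (top_le_iff.1 h') WithTop.coe_ne_top
    · intro h'; exact absurd h' not_top_lt
  | coe a =>
    rw [dyadicSucc_of_eq_coe h, WithTop.coe_le_coe, WithTop.coe_lt_coe, Literature.Analysis.FunctionSpaces.dyadicFloor,
      div_le_iff₀ (pow_pos two_pos n), lt_div_iff₀ (pow_pos two_pos n), ← NNReal.coe_le_coe,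
      ← NNReal.coe_lt_coe]
    push_cast
    constructor
    · intro hle
      -- `⌊a 2ⁿ⌋ + 1 ≤ ⌊t 2ⁿ⌋` as naturals
      have h1 : ⌊(a : ℝ) * 2 ^ n⌋₊ + 1 ≤ ⌊(t : ℝ) * 2 ^ n⌋₊ :=
        Nat.le_floor (by exact_mod_cast hle)
      calc (a : ℝ) * 2 ^ n < ⌊(a : ℝ) * 2 ^ n⌋₊ + 1 := Nat.lt_floor_add_one _
        _ = ((⌊(a : ℝ) * 2 ^ n⌋₊ + 1 : ℕ) : ℝ) := by push_cast; ring
        _ ≤ ⌊(t : ℝ) * 2 ^ n⌋₊ := by exact_mod_cast h1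
    · intro hlt
      have h1 : ⌊(a : ℝ) * 2 ^ n⌋₊ < ⌊(t : ℝ) * 2 ^ n⌋₊ := by
        have : (⌊(a : ℝ) * 2 ^ n⌋₊ : ℝ) < ⌊(t : ℝ) * 2 ^ n⌋₊ :=
          (Nat.floor_le (mul_nonneg a.2 h2.le)).trans_lt hlt
        exact_mod_cast this
      calc (⌊(a : ℝ) * 2 ^ n⌋₊ : ℝ) + 1 ≤ ⌊(t : ℝ) * 2 ^ n⌋₊ := by exact_mod_cast h1
        _ ≤ (t : ℝ) * 2 ^ n := Nat.floor_le (mul_nonneg t.2 h2.le)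

/-- **The dyadic upper approximation of an optional time is a stopping time of the raw
filtration**: `{dyadicSucc n ρ ≤ t} = {ρ < ⌊t2ⁿ⌋/2ⁿ} ∈ 𝓕_{⌊t2ⁿ⌋/2ⁿ} ⊆ 𝓕 t`.
Revuz–Yor, *Continuous Martingales and Brownian Motion* (1999), Ch. I, Prop. (4.11). [folklore] -/
theorem measurableSet_dyadicSucc_le (hρ : ∀ t : ℝ≥0, MeasurableSet[𝓕 t] {ω | ρ ω < t})
    (t : ℝ≥0) : MeasurableSet[𝓕 t] {ω | dyadicSucc n ρ ω ≤ t} := by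
  have heq : {ω | dyadicSucc n ρ ω ≤ t} = {ω | ρ ω < Literature.Analysis.FunctionSpaces.dyadicFloor n t} :=
    Set.ext fun ω ↦ dyadicSucc_le_coe_iff ω t
  rw [heq]
  exact 𝓕.mono (Literature.Analysis.FunctionSpaces.dyadicFloor_le n t) _ (hρ _)

/-- The dyadic successor is a measurable function of the time. [folklore] -/
theorem measurable_dyadicSucc_map (n : ℕ) :
    Measurable (WithTop.map fun a : ℝ≥0 ↦ ((⌊(a : ℝ) * 2 ^ n⌋₊ + 1 : ℕ) : ℝ≥0) / 2 ^ n) := by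
  refine WithTop.measurable_of_measurable_comp_coe ?_
  have h1 : Measurable fun a : ℝ≥0 ↦ ⌊(a : ℝ) * 2 ^ n⌋₊ :=
    (measurable_coe_nnreal_real.mul_const _).nat_floor
  have h2 : Measurable fun k : ℕ ↦ (((k + 1 : ℕ) : ℝ≥0) / 2 ^ n : ℝ≥0) := measurable_from_nat
  exact WithTop.measurable_coe.comp (h2.comp h1)

/-- The dyadic successor of a measurable random time is measurable. [folklore] -/
theorem measurable_dyadicSucc (hρm : Measurable ρ) : Measurable (dyadicSucc n ρ) :=
  (measurable_dyadicSucc_map n).comp hρm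

/-- An optional time of a filtration is measurable. [folklore] -/
theorem measurable_of_optional (hρ : ∀ t : ℝ≥0, MeasurableSet[𝓕 t] {ω | ρ ω < t}) :
    Measurable ρ := by
  refine measurable_of_Iio fun x ↦ ?_
  cases x with
  | top =>
    have heq : ρ ⁻¹' Set.Iio ⊤ = ⋃ k : ℕ, {ω | ρ ω < (k : ℝ≥0)} := by
      ext ω
      simp only [Set.mem_preimage, Set.mem_Iio, Set.mem_iUnion, Set.mem_setOf_eq]
      constructor
      · intro h
        obtain ⟨a, ha⟩ := WithTop.ne_top_iff_exists.1 h.ne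
        obtain ⟨k, hk⟩ := exists_nat_gt a
        exact ⟨k, by rw [← ha]; exact WithTop.coe_lt_coe.2 hk⟩
      · rintro ⟨k, hk⟩
        exact hk.trans (WithTop.coe_lt_top _)
    rw [heq]
    exact MeasurableSet.iUnion fun k ↦ 𝓕.le _ _ (hρ k)
  | coe t => exact 𝓕.le t _ (hρ t)

end DyadicSucc

namespace SimpleProcess

/-! ### The stopped approximants -/

section StopApprox

variable {ρ : Ω → WithTop ℝ≥0} (hρ : ∀ t : ℝ≥0, MeasurableSet[𝓕 t] {ω | ρ ω < t})

/-- **The stopped approximant** `K 1_{(0, ρₙ]}` (`ρₙ = dyadicSucc n ρ`) of a bounded simple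
process `K`, as a bounded simple process: refine the partition by the dyadic grid of mesh `2⁻ⁿ`
and stop at the grid-valued stopping time `ρₙ`.
Revuz–Yor, *Continuous Martingales and Brownian Motion* (1999), Ch. IV, Prop. (2.5). [folklore] -/
def stopApprox (K : SimpleProcess m 𝓕) (n : ℕ) : SimpleProcess m 𝓕 :=
  (K.withGrid n).stop (dyadicSucc n ρ) fun _ _ ↦ measurableSet_dyadicSucc_le hρ _

/-- The step process of the stopped approximant is `K 1_{(0,ρₙ]}`. [folklore] -/
theorem toProcess_stopApprox (K : SimpleProcess m 𝓕) (n : ℕ) (s : ℝ≥0) (ω : Ω) :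
    (K.stopApprox hρ n).toProcess s ω =
      if (s : WithTop ℝ≥0) ≤ dyadicSucc n ρ ω then K.toProcess s ω else 0 := by
  rw [stopApprox, toProcess_stop _ _ (fun ω i hi hlt ↦
    K.withGrid_cell n dyadicSucc_eq_top_or ω i hi hlt), toProcess_withGrid]

/-- **The elementary integral of the stopped approximant is the stopped elementary integral**:
`(K 1_{(0,ρₙ]})·B = (K·B)^{ρₙ}`.
Revuz–Yor, *Continuous Martingales and Brownian Motion* (1999), Ch. IV, Prop. (2.5). [folklore] -/
theorem integral_stopApprox (K : SimpleProcess m 𝓕) (n : ℕ) (B : ℝ≥0 → Ω → ℝ) (s : ℝ≥0) (ω : Ω) :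
    (K.stopApprox hρ n).integral B s ω = stoppedProcess (K.integral B) (dyadicSucc n ρ) s ω := by
  rw [stopApprox, integral_stop _ _ (fun ω i hi hlt ↦
    K.withGrid_cell n dyadicSucc_eq_top_or ω i hi hlt)]
  have : (K.withGrid n).integral B = K.integral B := by
    funext r ω'; exact K.integral_withGrid n B r ω'
  rw [this]

end StopApprox

/-! ### The stopped approximants approximate the stopped integrand -/

section Approx

variable [IsFiniteMeasure μ] {ρ : Ω → WithTop ℝ≥0}
  (hρ : ∀ t : ℝ≥0, MeasurableSet[𝓕 t] {ω | ρ ω < t}) {H : ℝ≥0 → Ω → ℝ}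
  {Hn : ℕ → SimpleProcess m 𝓕}

/-- **The stopped approximants `Hₙ 1_{(0,ρₙ]}` approximate the stopped integrand `H 1_{[0,ρ]}`**
(in the sense of `IsApproxSeq`) whenever `Hₙ` approximate `H` and `H` is jointly measurable:
`(Hₙ1_{(0,ρₙ]} - H1_{[0,ρ]})² ≤ 2(Hₙ - H)² + 2H²1_{(ρ,ρₙ]}`, and `∫₀ᵗ H² 1_{(ρ, ρ+2⁻ⁿ]} → 0` on
every path with `∫₀ᵗ H² < ∞` (dominated convergence).
Revuz–Yor, *Continuous Martingales and Brownian Motion* (1999), Ch. IV, Prop. (2.5) and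
Prop. (2.10)(ii). [folklore] -/
theorem isApproxSeq_stopApprox (hHn : IsApproxSeq Hn H μ)
    (hHm : Measurable fun p : Ω × ℝ ↦ H p.2.toNNReal p.1) :
    IsApproxSeq (fun n ↦ (Hn n).stopApprox hρ n) (Literature.Analysis.FunctionSpaces.trunc ρ H) μ := by
  have hρm : Measurable ρ := measurable_of_optional hρ
  have hH : ∀ ω, Measurable fun s : ℝ ↦ H s.toNNReal ω := measurable_path_of_measurable_toNNReal hHm
  have hfin := Literature.Analysis.FunctionSpaces.ae_lintegral_sq_lt_top_of_isApproxSeq hHn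
  -- the error indicator `e n ω s = H(s)² 1_{ρ < s ≤ ρₙ}`
  let e : ℕ → Ω → ℝ → ℝ≥0∞ := fun n ω s ↦
    if ρ ω < ((s.toNNReal : ℝ≥0) : WithTop ℝ≥0) ∧
        ((s.toNNReal : ℝ≥0) : WithTop ℝ≥0) ≤ dyadicSucc n ρ ω then
      ENNReal.ofReal (H s.toNNReal ω ^ 2) else 0
  have hem : ∀ n, Measurable fun p : Ω × ℝ ↦ e n p.1 p.2 := by
    intro n
    refine Measurable.ite ?_ ((hHm.pow_const 2).ennreal_ofReal) measurable_const
    have h1 : Measurable fun p : Ω × ℝ ↦ ((p.2.toNNReal : ℝ≥0) : WithTop ℝ≥0) :=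
      (measurable_real_toNNReal.comp measurable_snd).withTop_coe
    exact (measurableSet_lt (hρm.comp measurable_fst) h1).inter
      (measurableSet_le h1 ((measurable_dyadicSucc hρm).comp measurable_fst))
  have hem' : ∀ n ω, Measurable fun s : ℝ ↦ e n ω s := fun n ω ↦
    (hem n).comp (measurable_const.prodMk measurable_id)
  -- pointwise bound
  have hpt : ∀ n ω (s : ℝ), ENNReal.ofReal ((((Hn n).stopApprox hρ n).toProcess s.toNNReal ω -
      Literature.Analysis.FunctionSpaces.trunc ρ H s.toNNReal ω) ^ 2) ≤
      2 * ENNReal.ofReal (((Hn n).toProcess s.toNNReal ω - H s.toNNReal ω) ^ 2) + 2 * e n ω s := by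
    intro n ω s
    rw [toProcess_stopApprox, Literature.Analysis.FunctionSpaces.trunc_apply]
    by_cases h1 : ((s.toNNReal : ℝ≥0) : WithTop ℝ≥0) ≤ ρ ω
    · have h2 : ((s.toNNReal : ℝ≥0) : WithTop ℝ≥0) ≤ dyadicSucc n ρ ω :=
        h1.trans (le_dyadicSucc ω)
      rw [if_pos h2, if_pos h1]
      calc ENNReal.ofReal (((Hn n).toProcess s.toNNReal ω - H s.toNNReal ω) ^ 2)
          ≤ 2 * ENNReal.ofReal (((Hn n).toProcess s.toNNReal ω - H s.toNNReal ω) ^ 2) := by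
            rw [two_mul]; exact le_add_self
        _ ≤ _ := le_self_add
    · rw [if_neg h1]
      by_cases h2 : ((s.toNNReal : ℝ≥0) : WithTop ℝ≥0) ≤ dyadicSucc n ρ ω
      · rw [if_pos h2]
        have he : e n ω s = ENNReal.ofReal (H s.toNNReal ω ^ 2) := by
          simp only [e]; rw [if_pos ⟨not_le.1 h1, h2⟩]
        rw [he, sub_zero]
        set a := (Hn n).toProcess s.toNNReal ω
        set b := H s.toNNReal ω
        have hab : a ^ 2 ≤ 2 * (a - b) ^ 2 + 2 * b ^ 2 := by nlinarith [sq_nonneg (a - b - b)]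
        calc ENNReal.ofReal (a ^ 2) ≤ ENNReal.ofReal (2 * (a - b) ^ 2 + 2 * b ^ 2) :=
              ENNReal.ofReal_le_ofReal hab
          _ = 2 * ENNReal.ofReal ((a - b) ^ 2) + 2 * ENNReal.ofReal (b ^ 2) := by
              rw [ENNReal.ofReal_add (by positivity) (by positivity), ENNReal.ofReal_mul zero_le_two,
                ENNReal.ofReal_mul zero_le_two, ENNReal.ofReal_ofNat]
      · rw [if_neg h2]; simp
  -- integrated bound
  have hint : ∀ n ω (t : ℝ≥0), ∫⁻ s in Set.Icc (0 : ℝ) t, ENNReal.ofReal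
      ((((Hn n).stopApprox hρ n).toProcess s.toNNReal ω - Literature.Analysis.FunctionSpaces.trunc ρ H s.toNNReal ω) ^ 2) ≤
      2 * (∫⁻ s in Set.Icc (0 : ℝ) t,
        ENNReal.ofReal (((Hn n).toProcess s.toNNReal ω - H s.toNNReal ω) ^ 2)) +
      2 * ∫⁻ s in Set.Icc (0 : ℝ) t, e n ω s := by
    intro n ω t
    have hm1 : Measurable fun s : ℝ ↦
        ENNReal.ofReal (((Hn n).toProcess s.toNNReal ω - H s.toNNReal ω) ^ 2) :=
      ((((Hn n).measurable_toProcess_prod.comp (measurable_prodMk_left (x := ω))).sub (hH ω)).pow_const 2).ennreal_ofReal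
    calc _ ≤ ∫⁻ s in Set.Icc (0 : ℝ) t, (2 * ENNReal.ofReal
          (((Hn n).toProcess s.toNNReal ω - H s.toNNReal ω) ^ 2) + 2 * e n ω s) :=
          lintegral_mono fun s ↦ hpt n ω s
      _ = _ := by
          rw [lintegral_add_left (hm1.const_mul 2), lintegral_const_mul _ hm1,
            lintegral_const_mul _ (hem' n ω)]
  -- the error term tends to zero on every path with finite `∫₀ᵗ H²`
  have hE : ∀ᵐ ω ∂μ, ∀ t : ℝ≥0, Tendsto (fun n ↦ ∫⁻ s in Set.Icc (0 : ℝ) t, e n ω s) atTop (𝓝 0) := by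
    filter_upwards [hfin] with ω hω t
    have h := tendsto_lintegral_of_dominated_convergence
      (μ := (volume : Measure ℝ).restrict (Set.Icc (0 : ℝ) t))
      (F := fun n s ↦ e n ω s) (f := fun _ ↦ 0) (fun s ↦ ENNReal.ofReal (H s.toNNReal ω ^ 2))
      (hem' · ω) (fun n ↦ ae_of_all _ fun s ↦ ?_) (hω t).ne (ae_of_all _ fun s ↦ ?_)
    · simp only [lintegral_zero] at h
      exact h
    · show e n ω s ≤ _
      simp only [e]
      split_ifs
      · exact le_rfl
      · exact bot_le
    · -- eventually zero
      by_cases hs : ρ ω < ((s.toNNReal : ℝ≥0) : WithTop ℝ≥0)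
      · obtain ⟨a, ha⟩ := WithTop.ne_top_iff_exists.1 hs.ne_top
        have has : a < s.toNNReal := by rw [← ha] at hs; exact WithTop.coe_lt_coe.1 hs
        have hev : ∀ᶠ n : ℕ in atTop, a + 1 / 2 ^ n < s.toNNReal := by
          have hpos : (0 : ℝ) < (s.toNNReal : ℝ) - a := by
            have := NNReal.coe_lt_coe.2 has; linarith
          have h0 : Tendsto (fun n : ℕ ↦ (1 / 2 : ℝ) ^ n) atTop (𝓝 0) :=
            tendsto_pow_atTop_nhds_zero_of_lt_one (by norm_num) (by norm_num)
          filter_upwards [h0.eventually (gt_mem_nhds hpos)] with n hn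
          rw [← NNReal.coe_lt_coe]
          push_cast
          rw [div_pow, one_pow] at hn
          linarith
        refine tendsto_const_nhds.congr' ?_
        filter_upwards [hev] with n hn
        simp only [e]
        rw [if_neg]
        rintro ⟨-, h2⟩
        have h3 := h2.trans (dyadicSucc_le_add ha.symm)
        exact (not_lt.2 (WithTop.coe_le_coe.1 h3)) hn
      · refine tendsto_const_nhds.congr' (Eventually.of_forall fun n ↦ ?_)
        simp only [e]
        rw [if_neg fun h ↦ hs h.1]
  -- conclusion: the event is covered by two events of vanishing probability
  intro t ε hε
  have hε4 : 0 < ε / 4 := by positivity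
  have hA := hHn t (ε / 4) hε4
  have hEm : ∀ n, Measurable fun ω ↦ ∫⁻ s in Set.Icc (0 : ℝ) t, e n ω s := fun n ↦
    (hem n).lintegral_prod_right'
  have hS : ∀ n, MeasurableSet {ω | ENNReal.ofReal (ε / 4) ≤ ∫⁻ s in Set.Icc (0 : ℝ) t, e n ω s} :=
    fun n ↦ measurableSet_le measurable_const (hEm n)
  have hev : ∀ᵐ ω ∂μ, ∀ᶠ n in atTop,
      ω ∉ {ω | ENNReal.ofReal (ε / 4) ≤ ∫⁻ s in Set.Icc (0 : ℝ) t, e n ω s} := by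
    filter_upwards [hE] with ω hω
    filter_upwards [(hω t).eventually (gt_mem_nhds (ENNReal.ofReal_pos.2 hε4))] with n hn
    exact fun hmem ↦ (not_le.2 hn) hmem
  have hB := tendsto_measure_of_ae_eventually_notMem hS hev
  have hsub : ∀ n, {ω | ENNReal.ofReal ε ≤ ∫⁻ s in Set.Icc (0 : ℝ) t, ENNReal.ofReal
      ((((Hn n).stopApprox hρ n).toProcess s.toNNReal ω - Literature.Analysis.FunctionSpaces.trunc ρ H s.toNNReal ω) ^ 2)} ⊆
      {ω | ENNReal.ofReal (ε / 4) ≤ ∫⁻ s in Set.Icc (0 : ℝ) t,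
        ENNReal.ofReal (((Hn n).toProcess s.toNNReal ω - H s.toNNReal ω) ^ 2)} ∪
      {ω | ENNReal.ofReal (ε / 4) ≤ ∫⁻ s in Set.Icc (0 : ℝ) t, e n ω s} := by
    intro n ω hω
    simp only [Set.mem_setOf_eq, Set.mem_union] at hω ⊢
    by_contra hcon
    push Not at hcon
    refine (not_lt.2 hω) ((hint n ω t).trans_lt ?_)
    calc 2 * (∫⁻ s in Set.Icc (0 : ℝ) t,
            ENNReal.ofReal (((Hn n).toProcess s.toNNReal ω - H s.toNNReal ω) ^ 2)) +
          2 * ∫⁻ s in Set.Icc (0 : ℝ) t, e n ω s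
        < 2 * ENNReal.ofReal (ε / 4) + 2 * ENNReal.ofReal (ε / 4) := by
          refine ENNReal.add_lt_add ?_ ?_
          · exact (ENNReal.mul_lt_mul_iff_right (by norm_num) ENNReal.ofNat_ne_top).2 hcon.1
          · exact (ENNReal.mul_lt_mul_iff_right (by norm_num) ENNReal.ofNat_ne_top).2 hcon.2
      _ = ENNReal.ofReal ε := by
          rw [← ENNReal.ofReal_ofNat 2, ← ENNReal.ofReal_mul (by norm_num),
            ← ENNReal.ofReal_add (by positivity) (by positivity)]
          congr 1; ring
  have hlim : Tendsto (fun n ↦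
      μ {ω | ENNReal.ofReal (ε / 4) ≤ ∫⁻ s in Set.Icc (0 : ℝ) t,
        ENNReal.ofReal (((Hn n).toProcess s.toNNReal ω - H s.toNNReal ω) ^ 2)} +
      μ {ω | ENNReal.ofReal (ε / 4) ≤ ∫⁻ s in Set.Icc (0 : ℝ) t, e n ω s}) atTop (𝓝 0) := by
    simpa using hA.add hB
  exact tendsto_of_tendsto_of_tendsto_of_le_of_le tendsto_const_nhds hlim (fun n ↦ bot_le)
    fun n ↦ (measure_mono (hsub n)).trans (measure_union_le _ _)

end Approx

end SimpleProcess

/-! ### Oscillations of a.s. continuous paths and u.c.p. convergence of stopped processes -/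

section Osc

variable [IsFiniteMeasure μ] {J : ℝ≥0 → Ω → ℝ}

/-- **Small oscillations have small probability**: if `J` has measurable marginals and a.s.
continuous paths, then for `δ > 0` the probability that `|J_u - J_v| ≥ δ` for some
`u, v ≤ t` with `|u - v| ≤ 2⁻ⁿ` tends to `0` as `n → ∞` (uniform continuity on `[0, t+1]`;
measurability through rational times). [folklore] -/
theorem tendsto_measure_osc (hJm : ∀ s, Measurable (J s)) (hJc : ∀ᵐ ω ∂μ, Continuous (J · ω))
    (t : ℝ≥0) {δ : ℝ} (hδ : 0 < δ) :
    Tendsto (fun n : ℕ ↦ μ {ω | ∃ u ≤ t, ∃ v ≤ t, dist u v ≤ 1 / 2 ^ n ∧ δ ≤ |J u ω - J v ω|})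
      atTop (𝓝 0) := by
  -- countable test times
  let D : Set ℝ≥0 := Set.range (fun r : ℚ ↦ (r : ℝ).toNNReal)
  have hDc : D.Countable := Set.countable_range _
  let S : ℕ → Set Ω := fun n ↦ ⋃ q ∈ D, ⋃ q' ∈ D,
    {ω | q ≤ t + 1 ∧ q' ≤ t + 1 ∧ dist q q' < 2 / 2 ^ n ∧ δ / 2 < |J q ω - J q' ω|}
  have hSm : ∀ n, MeasurableSet (S n) := by
    intro n
    refine MeasurableSet.biUnion hDc fun q _ ↦ MeasurableSet.biUnion hDc fun q' _ ↦ ?_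
    by_cases h : (q ≤ t + 1 ∧ q' ≤ t + 1 ∧ dist q q' < 2 / 2 ^ n)
    · have : {ω | q ≤ t + 1 ∧ q' ≤ t + 1 ∧ dist q q' < 2 / 2 ^ n ∧ δ / 2 < |J q ω - J q' ω|} =
          {ω | δ / 2 < |J q ω - J q' ω|} := by
        ext ω; simp only [Set.mem_setOf_eq]; tauto
      rw [this]
      exact measurableSet_lt measurable_const (((hJm q).sub (hJm q')).abs)
    · have : {ω | q ≤ t + 1 ∧ q' ≤ t + 1 ∧ dist q q' < 2 / 2 ^ n ∧ δ / 2 < |J q ω - J q' ω|} = ∅ := by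
        ext ω; simp only [Set.mem_setOf_eq, Set.mem_empty_iff_false, iff_false]; tauto
      rw [this]
      exact MeasurableSet.empty
  -- a.e. eventually outside `S n` (uniform continuity on `[0, t + 1]`)
  have hev : ∀ᵐ ω ∂μ, ∀ᶠ n in atTop, ω ∉ S n := by
    filter_upwards [hJc] with ω hω
    have huc := (isCompact_Icc (a := (0 : ℝ≥0)) (b := t + 1)).uniformContinuousOn_of_continuous
      hω.continuousOn
    obtain ⟨η, hη, hηf⟩ := Metric.uniformContinuousOn_iff.1 huc (δ / 2) (by positivity)
    have h0 : Tendsto (fun n : ℕ ↦ (2 : ℝ) / 2 ^ n) atTop (𝓝 0) := by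
      have : Tendsto (fun n : ℕ ↦ (1 / 2 : ℝ) ^ n) atTop (𝓝 0) :=
        tendsto_pow_atTop_nhds_zero_of_lt_one (by norm_num) (by norm_num)
      have h2 := this.const_mul 2
      rw [mul_zero] at h2
      refine h2.congr fun n ↦ ?_
      rw [div_pow, one_pow]; ring
    filter_upwards [h0.eventually (gt_mem_nhds hη)] with n hn hmem
    simp only [S, Set.mem_iUnion, Set.mem_setOf_eq, exists_prop] at hmem
    obtain ⟨q, -, q', -, hq, hq', hd, hJ⟩ := hmem
    have := hηf q (Set.mem_Icc.2 ⟨bot_le, hq⟩) q' (Set.mem_Icc.2 ⟨bot_le, hq'⟩) (hd.trans hn)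
    rw [Real.dist_eq] at this
    linarith
  have hS0 := tendsto_measure_of_ae_eventually_notMem hSm hev
  -- inclusion on continuous paths
  have hsub : ∀ n ω, Continuous (J · ω) →
      (∃ u ≤ t, ∃ v ≤ t, dist u v ≤ 1 / 2 ^ n ∧ δ ≤ |J u ω - J v ω|) → ω ∈ S n := by
    rintro n ω hω ⟨u, hu, v, hv, hd, hJ⟩
    -- neighbourhoods of `u` and `v` where `J` moves by less than `δ / 4`
    have hcu := Metric.continuousAt_iff.1 (hω.continuousAt (x := u)) (δ / 4) (by positivity)
    have hcv := Metric.continuousAt_iff.1 (hω.continuousAt (x := v)) (δ / 4) (by positivity)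
    obtain ⟨η₁, hη₁, h₁⟩ := hcu
    obtain ⟨η₂, hη₂, h₂⟩ := hcv
    have h2n : (0 : ℝ) < 1 / 2 ^ (n + 1) := by positivity
    obtain ⟨r, hr, hrt⟩ := exists_rat_toNNReal_near (show u < t + 1 from lt_of_le_of_lt hu (lt_add_one t))
      (lt_min hη₁ h2n)
    obtain ⟨r', hr', hrt'⟩ := exists_rat_toNNReal_near (show v < t + 1 from lt_of_le_of_lt hv (lt_add_one t))
      (lt_min hη₂ h2n)
    simp only [S, Set.mem_iUnion, Set.mem_setOf_eq, exists_prop]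
    refine ⟨(r : ℝ).toNNReal, ⟨r, rfl⟩, (r' : ℝ).toNNReal, ⟨r', rfl⟩, hrt.le, hrt'.le, ?_, ?_⟩
    · have hr1 : dist ((r : ℝ).toNNReal) u < 1 / 2 ^ (n + 1) := hr.trans_le (min_le_right _ _)
      have hr3 : dist v ((r' : ℝ).toNNReal) < 1 / 2 ^ (n + 1) := by
        rw [dist_comm]; exact hr'.trans_le (min_le_right _ _)
      calc dist ((r : ℝ).toNNReal) ((r' : ℝ).toNNReal)
          ≤ dist ((r : ℝ).toNNReal) u + dist u v + dist v ((r' : ℝ).toNNReal) := dist_triangle4 _ _ _ _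
        _ < 1 / 2 ^ (n + 1) + 1 / 2 ^ n + 1 / 2 ^ (n + 1) :=
            add_lt_add (add_lt_add_of_lt_of_le hr1 hd) hr3
        _ = 2 / 2 ^ n := by rw [pow_succ]; field_simp; ring
    · have e1 := h₁ (hr.trans_le (min_le_left _ _))
      have e2 := h₂ (hr'.trans_le (min_le_left _ _))
      rw [Real.dist_eq] at e1 e2
      have htri : |J u ω - J v ω| ≤ |J ((r : ℝ).toNNReal) ω - J u ω| +
          |J ((r : ℝ).toNNReal) ω - J ((r' : ℝ).toNNReal) ω| + |J ((r' : ℝ).toNNReal) ω - J v ω| := by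
        calc |J u ω - J v ω| = |-(J ((r : ℝ).toNNReal) ω - J u ω) +
              (J ((r : ℝ).toNNReal) ω - J ((r' : ℝ).toNNReal) ω) +
              (J ((r' : ℝ).toNNReal) ω - J v ω)| := by ring_nf
          _ ≤ |-(J ((r : ℝ).toNNReal) ω - J u ω) + (J ((r : ℝ).toNNReal) ω - J ((r' : ℝ).toNNReal) ω)| +
              |J ((r' : ℝ).toNNReal) ω - J v ω| := abs_add_le _ _
          _ ≤ |-(J ((r : ℝ).toNNReal) ω - J u ω)| + |J ((r : ℝ).toNNReal) ω - J ((r' : ℝ).toNNReal) ω| +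
              |J ((r' : ℝ).toNNReal) ω - J v ω| := by gcongr; exact abs_add_le _ _
          _ = _ := by rw [abs_neg]
      linarith
  -- squeeze
  have hnull : μ {ω | ¬ Continuous (J · ω)} = 0 := ae_iff.1 hJc
  refine tendsto_of_tendsto_of_tendsto_of_le_of_le tendsto_const_nhds hS0 (fun n ↦ bot_le) fun n ↦ ?_
  calc μ {ω | ∃ u ≤ t, ∃ v ≤ t, dist u v ≤ 1 / 2 ^ n ∧ δ ≤ |J u ω - J v ω|}
      ≤ μ (S n ∪ {ω | ¬ Continuous (J · ω)}) := by
        refine measure_mono fun ω hω ↦ ?_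
        by_cases hc : Continuous (J · ω)
        · exact Or.inl (hsub n ω hc hω)
        · exact Or.inr hc
    _ ≤ μ (S n) + μ {ω | ¬ Continuous (J · ω)} := measure_union_le _ _
    _ = μ (S n) := by rw [hnull, add_zero]

/-- Geometry of stopping at `ρ` versus at `ρₙ = dyadicSucc n ρ`: for `s ≤ t`, the stopped times
`u = s ∧ ρₙ` and `v = s ∧ ρ` satisfy `u, v ≤ t` and `dist u v ≤ 2⁻ⁿ`. [folklore] -/
theorem dist_untopA_min_dyadicSucc_le (ρ : Ω → WithTop ℝ≥0) (n : ℕ) (ω : Ω) {s t : ℝ≥0}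
    (hs : s ≤ t) :
    (min (s : WithTop ℝ≥0) (dyadicSucc n ρ ω)).untopA ≤ t ∧
      (min (s : WithTop ℝ≥0) (ρ ω)).untopA ≤ t ∧
      dist (min (s : WithTop ℝ≥0) (dyadicSucc n ρ ω)).untopA (min (s : WithTop ℝ≥0) (ρ ω)).untopA ≤
        1 / 2 ^ n := by
  set u := (min (s : WithTop ℝ≥0) (dyadicSucc n ρ ω)).untopA with hu
  set v := (min (s : WithTop ℝ≥0) (ρ ω)).untopA with hv
  have huc : (u : WithTop ℝ≥0) = min (s : WithTop ℝ≥0) (dyadicSucc n ρ ω) :=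
    Literature.Analysis.FunctionSpaces.coe_untopA_min _ _
  have hvc : (v : WithTop ℝ≥0) = min (s : WithTop ℝ≥0) (ρ ω) := Literature.Analysis.FunctionSpaces.coe_untopA_min _ _
  have hus : u ≤ s := by rw [← WithTop.coe_le_coe, huc]; exact min_le_left _ _
  have hvs : v ≤ s := by rw [← WithTop.coe_le_coe, hvc]; exact min_le_left _ _
  have hvu : v ≤ u := by
    rw [← WithTop.coe_le_coe, huc, hvc]
    exact min_le_min le_rfl (le_dyadicSucc ω)
  have huv : u ≤ v + 1 / 2 ^ n := by
    cases h : ρ ω with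
    | top =>
      have h1 : (u : WithTop ℝ≥0) = s := by rw [huc, dyadicSucc_of_eq_top h, min_eq_left le_top]
      have h2 : (v : WithTop ℝ≥0) = s := by rw [hvc, h, min_eq_left le_top]
      have : u = v := WithTop.coe_inj.1 (h1.trans h2.symm)
      rw [this]; exact le_self_add
    | coe a =>
      have h1 : (u : WithTop ℝ≥0) ≤ ((min s (a + 1 / 2 ^ n) : ℝ≥0) : WithTop ℝ≥0) := by
        rw [huc, WithTop.coe_min]
        exact min_le_min le_rfl (dyadicSucc_le_add h)
      have h2 : (v : WithTop ℝ≥0) = ((min s a : ℝ≥0) : WithTop ℝ≥0) := by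
        rw [hvc, h, WithTop.coe_min]
      rw [WithTop.coe_le_coe] at h1
      rw [WithTop.coe_inj.1 h2]
      refine h1.trans ?_
      rcases le_total s a with hsa | has
      · rw [min_eq_left hsa, min_eq_left (hsa.trans le_self_add)]; exact le_self_add
      · rw [min_eq_right has]; exact min_le_right _ _
  refine ⟨hus.trans hs, hvs.trans hs, ?_⟩
  rw [NNReal.dist_eq, abs_of_nonneg (by simpa using hvu)]
  have := NNReal.coe_le_coe.2 huv
  push_cast at this
  linarith

/-- **u.c.p. convergence of stopped processes**: if `Yₙ → J` u.c.p., `J` has measurable marginals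
and a.s. continuous paths, then `Yₙ^{ρₙ} → J^ρ` u.c.p., where `ρₙ = dyadicSucc n ρ ↓ ρ` (any
random time `ρ`).
Revuz–Yor, *Continuous Martingales and Brownian Motion* (1999), Ch. IV, Prop. (2.10)(ii).
[folklore] -/
theorem tendstoUCP_stoppedProcess_dyadicSucc {Y : ℕ → ℝ≥0 → Ω → ℝ} (hY : TendstoUCP Y J μ)
    (hJm : ∀ s, Measurable (J s)) (hJc : ∀ᵐ ω ∂μ, Continuous (J · ω)) (ρ : Ω → WithTop ℝ≥0) :
    TendstoUCP (fun n ↦ stoppedProcess (Y n) (dyadicSucc n ρ)) (stoppedProcess J ρ) μ := by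
  intro t ε hε
  have hε2 : 0 < ε / 2 := by positivity
  have hsub : ∀ n, {ω | ∃ s ≤ t, ε ≤ |stoppedProcess (Y n) (dyadicSucc n ρ) s ω - stoppedProcess J ρ s ω|}
      ⊆ {ω | ∃ s ≤ t, ε / 2 ≤ |Y n s ω - J s ω|} ∪
        {ω | ∃ u ≤ t, ∃ v ≤ t, dist u v ≤ 1 / 2 ^ n ∧ ε / 2 ≤ |J u ω - J v ω|} := by
    rintro n ω ⟨s, hs, hεs⟩
    obtain ⟨hu, hv, hd⟩ := dist_untopA_min_dyadicSucc_le ρ n ω hs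
    simp only [stoppedProcess] at hεs
    set u := (min (s : WithTop ℝ≥0) (dyadicSucc n ρ ω)).untopA
    set v := (min (s : WithTop ℝ≥0) (ρ ω)).untopA
    by_contra hcon
    simp only [Set.mem_union, Set.mem_setOf_eq, not_or, not_exists, not_and, not_le] at hcon
    have h1 := hcon.1 u hu
    have h2 := hcon.2 u hu v hv hd
    have h3 : |Y n u ω - J v ω| ≤ |Y n u ω - J u ω| + |J u ω - J v ω| := abs_sub_le _ _ _
    linarith
  have hlim : Tendsto (fun n ↦ μ {ω | ∃ s ≤ t, ε / 2 ≤ |Y n s ω - J s ω|} +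
      μ {ω | ∃ u ≤ t, ∃ v ≤ t, dist u v ≤ 1 / 2 ^ n ∧ ε / 2 ≤ |J u ω - J v ω|}) atTop (𝓝 0) := by
    simpa using (hY t (ε / 2) hε2).add (tendsto_measure_osc hJm hJc t hε2)
  exact tendsto_of_tendsto_of_tendsto_of_le_of_le tendsto_const_nhds hlim (fun n ↦ bot_le)
    fun n ↦ (measure_mono (hsub n)).trans (measure_union_le _ _)

end Osc

/-! ### Stopping an Itô integral -/

section Main

variable [IsProbabilityMeasure μ] {B : ℝ≥0 → Ω → ℝ} {H J J' : ℝ≥0 → Ω → ℝ} {ρ : Ω → WithTop ℝ≥0}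

/-- **Stopping at an optional time truncates the integrand** (u.c.p.-limit form): let `B` be a
continuous square-integrable martingale with `B_t² - t` a martingale, `H` jointly measurable,
`ρ` an optional time (`{ρ < t} ∈ 𝓕 t`). If `J` is the u.c.p. limit of the elementary integrals
`Hₙ·B` along some approximating sequence `Hₙ` of `H` (no martingale property of `J` is needed),
and `J' = ∫ H 1_{[0,ρ]} dB` in the sense of `IsItoIntegral`, then `J'` is indistinguishable from
the stopped process `J^ρ`: the approximants `Hₙ 1_{(0,ρₙ]}` of `H 1_{[0,ρ]}` have elementary
integrals `(Hₙ·B)^{ρₙ} → J^ρ` u.c.p., and u.c.p. limits are unique.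
Revuz–Yor, *Continuous Martingales and Brownian Motion* (1999), Ch. IV, Prop. (2.5) and
Prop. (2.10)(ii). [cite: RevuzYor1999, Ch. IV Prop. (2.5) and Prop. (2.10)(ii)] -/
theorem ae_eq_stoppedProcess_of_tendstoUCP (hB : Martingale B 𝓕 μ)
    (hBsq : Martingale (fun t ω ↦ B t ω ^ 2 - (t : ℝ)) 𝓕 μ) (hB2 : ∀ t, MemLp (B t) 2 μ)
    (hBc : ∀ ω, Continuous (B · ω)) (hHm : Measurable fun p : Ω × ℝ ↦ H p.2.toNNReal p.1)
    (hρ : ∀ t : ℝ≥0, MeasurableSet[𝓕 t] {ω | ρ ω < t}) {Hn : ℕ → SimpleProcess m 𝓕}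
    (hHn : SimpleProcess.IsApproxSeq Hn H μ) (hJlim : TendstoUCP (fun n ↦ (Hn n).integral B) J μ)
    (hJ' : IsItoIntegral (Literature.Analysis.FunctionSpaces.trunc ρ H) B J' 𝓕 μ) :
    ∀ᵐ ω ∂μ, ∀ t, J' t ω = stoppedProcess J ρ t ω := by
  -- an adapted, a.s. continuous version `Ĵ` of `J` (u.c.p. limit without modification)
  obtain ⟨Jh, hJha, hJhc, -, hJhucp, -⟩ := exists_ucpLimit_integral hHn
    (measurable_path_of_measurable_toNNReal hHm) hB hBsq hB2 hBc
  have h1 : TendstoUCP (fun n ↦ (Hn n).integral B) Jh μ := hJhucp Hn hHn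
  have hJJh : ∀ᵐ ω ∂μ, ∀ t, J t ω = Jh t ω := hJlim.ae_eq h1
  -- the stopped approximants
  have hG : SimpleProcess.IsApproxSeq (fun n ↦ (Hn n).stopApprox hρ n) (Literature.Analysis.FunctionSpaces.trunc ρ H) μ :=
    SimpleProcess.isApproxSeq_stopApprox hρ hHn hHm
  have h2 : TendstoUCP (fun n ↦ ((Hn n).stopApprox hρ n).integral B) J' μ := hJ'.2.2.2.2 _ hG
  have h3 : TendstoUCP (fun n ↦ ((Hn n).stopApprox hρ n).integral B) (stoppedProcess Jh ρ) μ := by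
    have heq : (fun n ↦ ((Hn n).stopApprox hρ n).integral B) =
        fun n ↦ stoppedProcess ((Hn n).integral B) (dyadicSucc n ρ) := by
      funext n s ω
      exact SimpleProcess.integral_stopApprox hρ (Hn n) n B s ω
    rw [heq]
    exact tendstoUCP_stoppedProcess_dyadicSucc h1
      (fun s ↦ ((hJha s).mono (𝓕.le s)).measurable) hJhc ρ
  filter_upwards [h2.ae_eq h3, hJJh] with ω hω hω' t
  rw [hω t, stoppedProcess, stoppedProcess, hω']

/-- **Stopping an Itô integral at an optional time truncates the integrand**
(`(K·B)^ρ = (K 1_{[0,ρ]})·B`, characterised form, raw filtration): if `J = ∫ H dB` and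
`J' = ∫ H 1_{[0,ρ]} dB` in the sense of `IsItoIntegral` (`B` a continuous square-integrable
martingale with `B_t² - t` a martingale, `H` jointly measurable, `ρ` optional), then `J'` is
indistinguishable from `J^ρ`.
Revuz–Yor, *Continuous Martingales and Brownian Motion* (1999), Ch. IV, Prop. (2.5) and
Prop. (2.10)(ii). [cite: RevuzYor1999, Ch. IV Prop. (2.5) and Prop. (2.10)(ii)] -/
theorem IsItoIntegral.ae_eq_stoppedProcess (hB : Martingale B 𝓕 μ)
    (hBsq : Martingale (fun t ω ↦ B t ω ^ 2 - (t : ℝ)) 𝓕 μ) (hB2 : ∀ t, MemLp (B t) 2 μ)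
    (hBc : ∀ ω, Continuous (B · ω)) (hHm : Measurable fun p : Ω × ℝ ↦ H p.2.toNNReal p.1)
    (hρ : ∀ t : ℝ≥0, MeasurableSet[𝓕 t] {ω | ρ ω < t}) (hJ : IsItoIntegral H B J 𝓕 μ)
    (hJ' : IsItoIntegral (Literature.Analysis.FunctionSpaces.trunc ρ H) B J' 𝓕 μ) :
    ∀ᵐ ω ∂μ, ∀ t, J' t ω = stoppedProcess J ρ t ω := by
  obtain ⟨Hn, hHn⟩ := hJ.2.2.2.1
  exact ae_eq_stoppedProcess_of_tendstoUCP hB hBsq hB2 hBc hHm hρ hHn (hJ.2.2.2.2 Hn hHn) hJ'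

end Main

/-! ## The `L²` maximal inequality for characterised Itô integrals -/

section MaximalInequality

variable {Ω : Type*} {m : MeasurableSpace Ω} {𝓕 : Filtration ℝ≥0 m} {μ : Measure Ω}

/-! ### Linearity of approximating sequences and of u.c.p. limits -/

/-- Differences of approximating sequences approximate the difference (integrands with Borel
paths). [folklore] -/
theorem SimpleProcess.IsApproxSeq.sub {Hn Kn : ℕ → SimpleProcess m 𝓕} {H K : ℝ≥0 → Ω → ℝ}
    (hHn : SimpleProcess.IsApproxSeq Hn H μ) (hKn : SimpleProcess.IsApproxSeq Kn K μ)
    (hH : ∀ ω, Measurable fun s : ℝ ↦ H s.toNNReal ω)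
    (hK : ∀ ω, Measurable fun s : ℝ ↦ K s.toNNReal ω) :
    SimpleProcess.IsApproxSeq (fun n ↦ (Hn n).sub (Kn n)) (fun s ω ↦ H s ω - K s ω) μ := by
  intro t ε hε
  have hε4 : 0 < ε / 4 := by positivity
  -- pathwise bound
  have hint : ∀ n ω, ∫⁻ s in Set.Icc (0 : ℝ) t, ENNReal.ofReal
      ((((Hn n).sub (Kn n)).toProcess s.toNNReal ω - (H s.toNNReal ω - K s.toNNReal ω)) ^ 2) ≤
      2 * (∫⁻ s in Set.Icc (0 : ℝ) t,
        ENNReal.ofReal (((Hn n).toProcess s.toNNReal ω - H s.toNNReal ω) ^ 2)) +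
      2 * ∫⁻ s in Set.Icc (0 : ℝ) t,
        ENNReal.ofReal (((Kn n).toProcess s.toNNReal ω - K s.toNNReal ω) ^ 2) := by
    intro n ω
    have hm1 : Measurable fun s : ℝ ↦
        ENNReal.ofReal (((Hn n).toProcess s.toNNReal ω - H s.toNNReal ω) ^ 2) :=
      ((((Hn n).measurable_toProcess_prod.comp (measurable_prodMk_left (x := ω))).sub (hH ω)).pow_const 2).ennreal_ofReal
    have hm2 : Measurable fun s : ℝ ↦
        ENNReal.ofReal (((Kn n).toProcess s.toNNReal ω - K s.toNNReal ω) ^ 2) :=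
      ((((Kn n).measurable_toProcess_prod.comp (measurable_prodMk_left (x := ω))).sub (hK ω)).pow_const 2).ennreal_ofReal
    rw [← lintegral_const_mul _ hm1, ← lintegral_const_mul _ hm2,
      ← lintegral_add_left (hm1.const_mul 2)]
    refine lintegral_mono fun s ↦ ?_
    rw [(Hn n).toProcess_sub (Kn n)]
    set a := (Hn n).toProcess s.toNNReal ω - H s.toNNReal ω
    set c := (Kn n).toProcess s.toNNReal ω - K s.toNNReal ω
    have heq : (Hn n).toProcess s.toNNReal ω - (Kn n).toProcess s.toNNReal ω -
        (H s.toNNReal ω - K s.toNNReal ω) = a - c := by ring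
    rw [heq]
    have hle : (a - c) ^ 2 ≤ 2 * a ^ 2 + 2 * c ^ 2 := by nlinarith [sq_nonneg (a + c)]
    calc ENNReal.ofReal ((a - c) ^ 2) ≤ ENNReal.ofReal (2 * a ^ 2 + 2 * c ^ 2) :=
          ENNReal.ofReal_le_ofReal hle
      _ = 2 * ENNReal.ofReal (a ^ 2) + 2 * ENNReal.ofReal (c ^ 2) := by
          rw [ENNReal.ofReal_add (by positivity) (by positivity), ENNReal.ofReal_mul zero_le_two,
            ENNReal.ofReal_mul zero_le_two, ENNReal.ofReal_ofNat]
  have hsub : ∀ n, {ω | ENNReal.ofReal ε ≤ ∫⁻ s in Set.Icc (0 : ℝ) t, ENNReal.ofReal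
      ((((Hn n).sub (Kn n)).toProcess s.toNNReal ω - (H s.toNNReal ω - K s.toNNReal ω)) ^ 2)} ⊆
      {ω | ENNReal.ofReal (ε / 4) ≤ ∫⁻ s in Set.Icc (0 : ℝ) t,
        ENNReal.ofReal (((Hn n).toProcess s.toNNReal ω - H s.toNNReal ω) ^ 2)} ∪
      {ω | ENNReal.ofReal (ε / 4) ≤ ∫⁻ s in Set.Icc (0 : ℝ) t,
        ENNReal.ofReal (((Kn n).toProcess s.toNNReal ω - K s.toNNReal ω) ^ 2)} := by
    intro n ω hω
    simp only [Set.mem_setOf_eq, Set.mem_union] at hω ⊢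
    by_contra hcon
    push Not at hcon
    refine (not_lt.2 hω) ((hint n ω).trans_lt ?_)
    calc 2 * (∫⁻ s in Set.Icc (0 : ℝ) t,
            ENNReal.ofReal (((Hn n).toProcess s.toNNReal ω - H s.toNNReal ω) ^ 2)) +
          2 * ∫⁻ s in Set.Icc (0 : ℝ) t,
            ENNReal.ofReal (((Kn n).toProcess s.toNNReal ω - K s.toNNReal ω) ^ 2)
        < 2 * ENNReal.ofReal (ε / 4) + 2 * ENNReal.ofReal (ε / 4) := by
          refine ENNReal.add_lt_add ?_ ?_
          · exact (ENNReal.mul_lt_mul_iff_right (by norm_num) ENNReal.ofNat_ne_top).2 hcon.1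
          · exact (ENNReal.mul_lt_mul_iff_right (by norm_num) ENNReal.ofNat_ne_top).2 hcon.2
      _ = ENNReal.ofReal ε := by
          rw [← ENNReal.ofReal_ofNat 2, ← ENNReal.ofReal_mul (by norm_num),
            ← ENNReal.ofReal_add (by positivity) (by positivity)]
          congr 1; ring
  have hlim : Tendsto (fun n ↦
      μ {ω | ENNReal.ofReal (ε / 4) ≤ ∫⁻ s in Set.Icc (0 : ℝ) t,
        ENNReal.ofReal (((Hn n).toProcess s.toNNReal ω - H s.toNNReal ω) ^ 2)} +
      μ {ω | ENNReal.ofReal (ε / 4) ≤ ∫⁻ s in Set.Icc (0 : ℝ) t,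
        ENNReal.ofReal (((Kn n).toProcess s.toNNReal ω - K s.toNNReal ω) ^ 2)}) atTop (𝓝 0) := by
    simpa using (hHn t (ε / 4) hε4).add (hKn t (ε / 4) hε4)
  exact tendsto_of_tendsto_of_tendsto_of_le_of_le tendsto_const_nhds hlim (fun n ↦ bot_le)
    fun n ↦ (measure_mono (hsub n)).trans (measure_union_le _ _)

/-- **Linearity of the characterised Itô integral at the level of u.c.p. limits**: if
`J = ∫ H dB` and `J' = ∫ H' dB` (`IsItoIntegral`, Borel paths), then along *every* approximating
sequence `Kₙ` of `H - H'` the elementary integrals `Kₙ·B` converge u.c.p. to `J - J'`.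
Revuz–Yor, *Continuous Martingales and Brownian Motion* (1999), Ch. IV, Thm (2.2) (linearity of
`K ↦ K·M`). [folklore] -/
theorem IsItoIntegral.tendstoUCP_integral_sub {B H H' J J' : ℝ≥0 → Ω → ℝ}
    (hJ : IsItoIntegral H B J 𝓕 μ) (hJ' : IsItoIntegral H' B J' 𝓕 μ)
    (hH : ∀ ω, Measurable fun s : ℝ ↦ H s.toNNReal ω)
    (hH' : ∀ ω, Measurable fun s : ℝ ↦ H' s.toNNReal ω) {Kn : ℕ → SimpleProcess m 𝓕}
    (hKn : SimpleProcess.IsApproxSeq Kn (fun s ω ↦ H s ω - H' s ω) μ) :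
    TendstoUCP (fun n ↦ (Kn n).integral B) (fun s ω ↦ J s ω - J' s ω) μ := by
  obtain ⟨Hn, hHn⟩ := hJ.2.2.2.1
  have hK : ∀ ω, Measurable fun s : ℝ ↦ H s.toNNReal ω - H' s.toNNReal ω := fun ω ↦ (hH ω).sub (hH' ω)
  -- `Gₙ = Hₙ - Kₙ` approximates `H - (H - H') = H'`
  have hGn : SimpleProcess.IsApproxSeq (fun n ↦ (Hn n).sub (Kn n)) H' μ := by
    have h := hHn.sub hKn hH hK
    have heq : (fun s ω ↦ H s ω - (H s ω - H' s ω)) = H' := by funext s ω; ring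
    rwa [heq] at h
  have h1 : TendstoUCP (fun n ↦ (Hn n).integral B) J μ := hJ.2.2.2.2 Hn hHn
  have h2 : TendstoUCP (fun n ↦ ((Hn n).sub (Kn n)).integral B) J' μ := hJ'.2.2.2.2 _ hGn
  -- u.c.p. limits subtract (the `ε/2` argument of `TendstoUCP.of_sub`)
  have h3 : TendstoUCP (fun n s ω ↦ (Hn n).integral B s ω - ((Hn n).sub (Kn n)).integral B s ω)
      (fun s ω ↦ J s ω - J' s ω) μ := by
    intro t ε hε
    have hε2 : 0 < ε / 2 := by positivity
    refine tendsto_of_tendsto_of_tendsto_of_le_of_le tendsto_const_nhds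
      (by simpa using (h1 t (ε / 2) hε2).add (h2 t (ε / 2) hε2)) (fun n ↦ bot_le) fun n ↦ ?_
    refine (measure_mono ?_).trans (measure_union_le _ _)
    rintro ω ⟨s, hs, hεs⟩
    by_contra hcon
    simp only [Set.mem_union, Set.mem_setOf_eq, not_or, not_exists, not_and, not_le] at hcon
    have e : |((Hn n).integral B s ω - ((Hn n).sub (Kn n)).integral B s ω) - (J s ω - J' s ω)| ≤
        |(Hn n).integral B s ω - J s ω| + |((Hn n).sub (Kn n)).integral B s ω - J' s ω| := by
      calc |((Hn n).integral B s ω - ((Hn n).sub (Kn n)).integral B s ω) - (J s ω - J' s ω)|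
          = |((Hn n).integral B s ω - J s ω) - (((Hn n).sub (Kn n)).integral B s ω - J' s ω)| := by
            ring_nf
        _ ≤ _ := abs_sub _ _
    linarith [hcon.1 s hs, hcon.2 s hs]
  have heq : (fun n s ω ↦ (Hn n).integral B s ω - ((Hn n).sub (Kn n)).integral B s ω) =
      fun n ↦ (Kn n).integral B := by
    funext n s ω
    rw [(Hn n).integral_sub (Kn n) B s ω]
    ring
  rwa [heq] at h3

/-! ### Truncation at a deterministic time -/

/-- Truncation at the time horizon does not change the `L²(ds ⊗ μ)` size on shorter horizons and
kills everything beyond: `∫⁻∫⁻_{[0,t']} (K 1_{[0,t]})² ≤ ∫⁻∫⁻_{[0,t]} K²` for every `t'`.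
[folklore] -/
theorem sqErr_trunc_const_le {K : ℝ≥0 → Ω → ℝ}
    (hKm : Measurable fun p : Ω × ℝ ↦ K p.2.toNNReal p.1) (t t' : ℝ≥0) :
    sqErr (Literature.Analysis.FunctionSpaces.trunc (fun _ ↦ (t : WithTop ℝ≥0)) K) 0 μ t' ≤ sqErr K 0 μ t := by
  refine lintegral_mono fun ω ↦ ?_
  have hKω : Measurable fun s : ℝ ↦ ENNReal.ofReal ((K s.toNNReal ω - 0) ^ 2) :=
    (((measurable_path_of_measurable_toNNReal hKm ω).sub measurable_const).pow_const 2).ennreal_ofReal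
  calc ∫⁻ s in Set.Icc (0 : ℝ) t', ENNReal.ofReal
        ((Literature.Analysis.FunctionSpaces.trunc (fun _ ↦ (t : WithTop ℝ≥0)) K s.toNNReal ω - (0 : ℝ≥0 → Ω → ℝ) s.toNNReal ω) ^ 2)
      ≤ ∫⁻ s in Set.Icc (0 : ℝ) t', (Set.Icc (0 : ℝ) t).indicator
          (fun s ↦ ENNReal.ofReal ((K s.toNNReal ω - 0) ^ 2)) s := by
        refine setLIntegral_mono' measurableSet_Icc fun s hs ↦ ?_
        simp only [Literature.Analysis.FunctionSpaces.trunc, Pi.zero_apply, Set.indicator_apply, Set.mem_Icc, WithTop.coe_le_coe]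
        by_cases h : s.toNNReal ≤ t
        · rw [if_pos h, if_pos ⟨hs.1, Real.toNNReal_le_iff_le_coe.1 h⟩]
        · rw [if_neg h, if_neg (fun h' ↦ h (Real.toNNReal_le_iff_le_coe.2 h'.2))]
          simp
    _ = ∫⁻ s in Set.Icc (0 : ℝ) t' ∩ Set.Icc (0 : ℝ) t, ENNReal.ofReal ((K s.toNNReal ω - 0) ^ 2) := by
        rw [lintegral_indicator measurableSet_Icc, Measure.restrict_restrict measurableSet_Icc,
          Set.inter_comm]
    _ ≤ ∫⁻ s in Set.Icc (0 : ℝ) t, ENNReal.ofReal ((K s.toNNReal ω - (0 : ℝ≥0 → Ω → ℝ) s.toNNReal ω) ^ 2) :=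
        lintegral_mono_set Set.inter_subset_right

/-! ### Minkowski in the forms used below -/

/-- Minkowski's inequality in `L²`, `ℝ≥0∞` form for real functions. [folklore] -/
theorem sqrt_lintegral_add_sq_le {α : Type*} {mα : MeasurableSpace α} {ν : Measure α}
    {a b : α → ℝ} (ha : AEMeasurable a ν) (hb : AEMeasurable b ν) :
    (∫⁻ x, ENNReal.ofReal ((a x + b x) ^ 2) ∂ν) ^ (1 / 2 : ℝ) ≤
      (∫⁻ x, ENNReal.ofReal (a x ^ 2) ∂ν) ^ (1 / 2 : ℝ) +
        (∫⁻ x, ENNReal.ofReal (b x ^ 2) ∂ν) ^ (1 / 2 : ℝ) := by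
  have h := ENNReal.lintegral_Lp_add_le (p := 2) (μ := ν) ha.enorm hb.enorm one_le_two
  have hsq : ∀ y : ℝ, ENNReal.ofReal (y ^ 2) = ‖y‖ₑ ^ (2 : ℝ) := fun y ↦ by
    rw [ENNReal.rpow_two, Real.enorm_eq_ofReal_abs, ← ENNReal.ofReal_pow (abs_nonneg _), sq_abs]
  simp only [hsq]
  refine le_trans ?_ h
  gcongr with x
  exact enorm_add_le _ _

/-! ### The `L²` maximal inequality -/

section Maximal

variable [IsProbabilityMeasure μ] {B H H' J J' : ℝ≥0 → Ω → ℝ}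

/-- **The `L²` maximal inequality for characterised Itô integrals** (raw filtration): for
`J = ∫ H dB`, `J' = ∫ H' dB` with `H, H'` progressive and `B` a continuous square-integrable
martingale with `B_t² - t` a martingale,
`∫⁻ ⨆_{s ≤ t} (J_s - J'_s)² ≤ 4 ∫⁻ ∫⁻_{[0,t]} (H_s - H'_s)² ds`.
Revuz–Yor, *Continuous Martingales and Brownian Motion* (1999), Ch. IV, Thm (2.2) and Ch. II,
Thm (1.7); Ch. IX, proof of Thm (2.1). [cite: RevuzYor1999, Ch. IV Thm (2.2) and Ch. II Thm (1.7)] -/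
theorem IsItoIntegral.lintegral_iSup_sub_sq_le (hB : Martingale B 𝓕 μ)
    (hBsq : Martingale (fun t ω ↦ B t ω ^ 2 - (t : ℝ)) 𝓕 μ) (hB2 : ∀ t, MemLp (B t) 2 μ)
    (hBc : ∀ ω, Continuous (B · ω)) (hH : IsStronglyProgressive 𝓕 H)
    (hH' : IsStronglyProgressive 𝓕 H') (hJ : IsItoIntegral H B J 𝓕 μ)
    (hJ' : IsItoIntegral H' B J' 𝓕 μ) (t : ℝ≥0) :
    ∫⁻ ω, ⨆ s ∈ Set.Iic t, ENNReal.ofReal ((J s ω - J' s ω) ^ 2) ∂μ ≤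
      4 * ∫⁻ ω, (∫⁻ s in Set.Icc (0 : ℝ) t,
        ENNReal.ofReal ((H s.toNNReal ω - H' s.toNNReal ω) ^ 2)) ∂μ := by
  -- the difference integrand and its size
  set K : ℝ≥0 → Ω → ℝ := fun s ω ↦ H s ω - H' s ω with hKdef
  have hKp : IsStronglyProgressive 𝓕 K := hH.sub hH'
  have hKm := measurable_toNNReal_of_isStronglyProgressive hKp
  set R := sqErr K 0 μ t with hR
  have hRHS : ∫⁻ ω, (∫⁻ s in Set.Icc (0 : ℝ) t,
      ENNReal.ofReal ((H s.toNNReal ω - H' s.toNNReal ω) ^ 2)) ∂μ = R := by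
    simp [hR, sqErr, hKdef]
  rw [hRHS]
  rcases eq_or_ne R ∞ with hRtop | hRtop
  · rw [hRtop]; simp
  -- truncate at `t` and integrate: `L_t = ∫ K 1_{[0,t]} dB`, a square-integrable martingale
  set Kt := Literature.Analysis.FunctionSpaces.trunc (fun _ ↦ (t : WithTop ℝ≥0)) K with hKt
  have hKtp : IsStronglyProgressive 𝓕 Kt :=
    Literature.Analysis.FunctionSpaces.isStronglyProgressive_trunc hKp fun u ↦ MeasurableSet.const _
  have hKtm := measurable_toNNReal_of_isStronglyProgressive hKtp
  have hKtfin : ∀ t', sqErr Kt 0 μ t' ≠ ∞ := fun t' ↦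
    ne_top_of_le_ne_top hRtop (sqErr_trunc_const_le hKm t t')
  obtain ⟨L, hL, hLM, hL2, Kn, hKn, hKnL⟩ := exists_isItoIntegral_of_sqErr_ne_top hB hBsq hB2 hBc
    hKtp hKtfin
  -- `L` is indistinguishable from `(J - J')^t`
  obtain ⟨Hn, hHn⟩ := hJ.2.2.2.1
  have hHpath := measurable_path_of_measurable_toNNReal (measurable_toNNReal_of_isStronglyProgressive hH)
  have hH'path := measurable_path_of_measurable_toNNReal (measurable_toNNReal_of_isStronglyProgressive hH')
  obtain ⟨Gn, hGn⟩ : ∃ Gn : ℕ → SimpleProcess m 𝓕, SimpleProcess.IsApproxSeq Gn K μ := by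
    obtain ⟨Hn', hHn'⟩ := hJ'.2.2.2.1
    exact ⟨_, hHn.sub hHn' hHpath hH'path⟩
  have hGlim : TendstoUCP (fun n ↦ (Gn n).integral B) (fun s ω ↦ J s ω - J' s ω) μ :=
    hJ.tendstoUCP_integral_sub hJ' hHpath hH'path hGn
  have hopt : ∀ r : ℝ≥0, MeasurableSet[𝓕 r] {ω | (fun _ : Ω ↦ (t : WithTop ℝ≥0)) ω < r} := fun r ↦ by
    by_cases h : (t : WithTop ℝ≥0) < r
    · simp only [h, Set.setOf_true, MeasurableSet.univ]
    · simp only [h, Set.setOf_false, MeasurableSet.empty]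
  have hLeq : ∀ᵐ ω ∂μ, ∀ s, L s ω = stoppedProcess (fun s ω ↦ J s ω - J' s ω)
      (fun _ ↦ (t : WithTop ℝ≥0)) s ω :=
    ae_eq_stoppedProcess_of_tendstoUCP hB hBsq hB2 hBc hKm hopt hGn hGlim hL
  -- Doob for `L`
  have hDoob := doob_lintegral_iSup_sq_le_of_continuous hLM hL2 hL.continuous t
  -- `E[L_t²] ≤ R` by the isometry in the limit (Minkowski twice)
  have hLt : ∫⁻ ω, ENNReal.ofReal (L t ω ^ 2) ∂μ ≤ R := by
    set X := ∫⁻ ω, ENNReal.ofReal (L t ω ^ 2) ∂μ with hX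
    have hLm : AEMeasurable (L t) μ := ((hLM.stronglyAdapted t).mono (𝓕.le t)).measurable.aemeasurable
    have hIm : ∀ n, AEMeasurable ((Kn n).integral B t) μ := fun n ↦
      (((Kn n).stronglyMeasurable_integral hB.stronglyAdapted t).mono (𝓕.le t)).measurable.aemeasurable
    -- the bound for each `n`
    have hbound : ∀ n, X ^ (1 / 2 : ℝ) ≤ ((Kn n).approxErr Kt μ t) ^ (1 / 2 : ℝ) + R ^ (1 / 2 : ℝ) +
        (∫⁻ ω, ENNReal.ofReal (((Kn n).integral B t ω - L t ω) ^ 2) ∂μ) ^ (1 / 2 : ℝ) := by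
      intro n
      -- Minkowski in `ω`: `L_t = (Kₙ·B)_t + (L_t - (Kₙ·B)_t)`
      have h1 : X ^ (1 / 2 : ℝ) ≤ (∫⁻ ω, ENNReal.ofReal ((Kn n).integral B t ω ^ 2) ∂μ) ^ (1 / 2 : ℝ) +
          (∫⁻ ω, ENNReal.ofReal (((Kn n).integral B t ω - L t ω) ^ 2) ∂μ) ^ (1 / 2 : ℝ) := by
        have h := sqrt_lintegral_add_sq_le (ν := μ) (a := fun ω ↦ (Kn n).integral B t ω)
          (b := fun ω ↦ L t ω - (Kn n).integral B t ω) (hIm n) (hLm.sub (hIm n))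
        have heq : ∀ ω, (Kn n).integral B t ω + (L t ω - (Kn n).integral B t ω) = L t ω :=
          fun ω ↦ by ring
        simp only [heq] at h
        refine h.trans ?_
        gcongr ?_ + (∫⁻ ω, ENNReal.ofReal ?_ ∂μ) ^ _
        · exact le_rfl
        · rw [← neg_sub, neg_sq]
      -- isometry: `E[(Kₙ·B)_t²] = sqErr Kₙ 0 t`
      have h2 : ∫⁻ ω, ENNReal.ofReal ((Kn n).integral B t ω ^ 2) ∂μ = sqErr (Kn n).toProcess 0 μ t := by
        simp only [sqErr, Pi.zero_apply, sub_zero]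
        exact (Kn n).lintegral_integral_sq hB hBsq hB2 t
      -- Minkowski in `(ω, s)`: `Kₙ = (Kₙ - K_t) + K_t`
      have h3 : (sqErr (Kn n).toProcess 0 μ t) ^ (1 / 2 : ℝ) ≤
          ((Kn n).approxErr Kt μ t) ^ (1 / 2 : ℝ) + R ^ (1 / 2 : ℝ) := by
        have hKnm : Measurable fun p : Ω × ℝ ↦ (Kn n).toProcess p.2.toNNReal p.1 :=
          (Kn n).measurable_toProcess_prod
        have h0 : Measurable fun p : Ω × ℝ ↦ (0 : ℝ≥0 → Ω → ℝ) p.2.toNNReal p.1 := measurable_const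
        rw [sqErr_eq_lintegral_prod hKnm h0, SimpleProcess.approxErr_eq_sqErr,
          sqErr_eq_lintegral_prod hKnm hKtm]
        have h := sqrt_lintegral_add_sq_le (ν := μ.prod (volume.restrict (Set.Icc (0 : ℝ) t)))
          (a := fun p : Ω × ℝ ↦ (Kn n).toProcess p.2.toNNReal p.1 - Kt p.2.toNNReal p.1)
          (b := fun p : Ω × ℝ ↦ Kt p.2.toNNReal p.1 - (0 : ℝ≥0 → Ω → ℝ) p.2.toNNReal p.1)
          (hKnm.sub hKtm).aemeasurable (hKtm.sub h0).aemeasurable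
        have heq : ∀ p : Ω × ℝ, (Kn n).toProcess p.2.toNNReal p.1 - Kt p.2.toNNReal p.1 +
            (Kt p.2.toNNReal p.1 - (0 : ℝ≥0 → Ω → ℝ) p.2.toNNReal p.1) =
            (Kn n).toProcess p.2.toNNReal p.1 - (0 : ℝ≥0 → Ω → ℝ) p.2.toNNReal p.1 := fun p ↦ by ring
        simp only [heq] at h
        refine h.trans ?_
        gcongr ?_ + ?_
        · exact le_rfl
        · rw [← sqErr_eq_lintegral_prod hKtm h0]
          gcongr
          exact sqErr_trunc_const_le hKm t t
      calc X ^ (1 / 2 : ℝ) ≤ _ := h1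
        _ ≤ _ := by rw [h2]; gcongr
    -- pass to the limit
    have hlim : Tendsto (fun n ↦ ((Kn n).approxErr Kt μ t) ^ (1 / 2 : ℝ) + R ^ (1 / 2 : ℝ) +
        (∫⁻ ω, ENNReal.ofReal (((Kn n).integral B t ω - L t ω) ^ 2) ∂μ) ^ (1 / 2 : ℝ)) atTop
        (𝓝 (R ^ (1 / 2 : ℝ))) := by
      have hc := (ENNReal.continuous_rpow_const (y := (1 / 2 : ℝ))).tendsto 0
      rw [ENNReal.zero_rpow_of_pos (by norm_num)] at hc
      have ha := hc.comp (hKn t)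
      have hb := hc.comp (hKnL t)
      have := (ha.add (tendsto_const_nhds (x := R ^ (1 / 2 : ℝ)))).add hb
      simpa using this
    have hsqrt : X ^ (1 / 2 : ℝ) ≤ R ^ (1 / 2 : ℝ) := ge_of_tendsto' hlim hbound
    exact (ENNReal.rpow_le_rpow_iff (by norm_num : (0 : ℝ) < 1 / 2)).1 hsqrt
  -- assemble
  calc ∫⁻ ω, ⨆ s ∈ Set.Iic t, ENNReal.ofReal ((J s ω - J' s ω) ^ 2) ∂μ
      = ∫⁻ ω, ⨆ s ∈ Set.Iic t, ENNReal.ofReal (L s ω ^ 2) ∂μ := by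
        refine lintegral_congr_ae (hLeq.mono fun ω hω ↦ ?_)
        refine biSup_congr fun s hs ↦ ?_
        rw [hω s, stoppedProcess_eq_of_le (u := fun s ω ↦ J s ω - J' s ω)
          (τ := fun _ ↦ (t : WithTop ℝ≥0)) (ω := ω) (WithTop.coe_le_coe.2 (Set.mem_Iic.1 hs))]
    _ ≤ 4 * ∫⁻ ω, ENNReal.ofReal (L t ω ^ 2) ∂μ := hDoob
    _ ≤ 4 * R := by gcongr

end Maximal

end MaximalInequality

end Literature.Probability.Process

end
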